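import Literature.IUT.HodgeArakelov.EtaleThetaDataSignTransport
import Literature.AnabelianGeometry.EtaleTheta.Discharge.Sec2DtpYThetaAbelian
import Literature.AnabelianGeometry.EtaleTheta.ThetaCovers

/-!
# The `X̲̲`-layer index facts `[Π^tp_Ÿ : Π^tp_Ÿ̲̲] = [Δ^tp_Ÿ : Δ^tp_Ÿ̲̲] = l` and the power condition `hpow`
# of [EtTh] §1's translate lemma, at the model `Π := Π^tp_X̲̲`

Mochizuki, *The étale theta function …*, Publ. RIMS **45** (2009): Def. 2.7 p. 41 ("new coverings `Ÿ̲̲ → Ÿ`;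
`Y̲̲ → Y` of degree `l`", "`Π^tp_X̲̲/Π^tp_Ÿ̲̲ ≅ (l·ℤ) × μ₂`"), Prop. 2.2 (iii) p. 37 ("`G_K ≅ Π_X̲̲/Δ_X̲̲`"), §1 p. 12
("abelian profinite groups `1 → Δ_Θ → (Δ^tp_Y)^Θ → (Δ^tp_Y)^ell → 1`") [cite: MochizukiEtTh2009, Def 2.7 p.41].

PROOF-ONLY companion (no definitions; cell abc-iut, seat abc-iut-L2-t8 = owner of the `X̲̲` layer `DoubleUnderline.lean`;
GAP row G-w4d010-2 (R3)). It supplies, at the model data `C : E.DoubleUnderline l`, the two residual inputs that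
abc-iut-L2-t1's `Discharge/Sec1TranslatesNonTorsion.lean` (p415695, `not_isOfFinOrder_comap_conj_zpow_div`) names for
the `X̲̲` layer:
* `toZ_ne_one_of_toLZ` — `hγ`: a `toLZ`-generator of `Π^tp_X̲̲` has nonzero image `l` in `Z`;
* `relIndex_Huu_GtpYdd` (`[Π^tp_Ÿ : Π^tp_Ÿ̲̲] = l`), `sup_inf_deltaTemp_eq_GtpYdd` (`Π^tp_Ÿ = Π^tp_Ÿ̲̲·Δ^tp_Ÿ`),
  `relIndex_geometric` (`[Δ^tp_Ÿ : Δ^tp_Ÿ̲̲] = l`), hence **`pow_mem_map_of_origin`** — `hpow`: every `l`-th power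
  of `(Δ^tp_Ÿ)^Θ` lies in the image of `Δ^tp_Ÿ̲̲` (`(Δ^tp_Y)^Θ` is abelian: this seat's gen-2 `dtpYTheta_comm` under
  `IsEtThOrigin`; the image of `Δ^tp_Ÿ̲̲` has index dividing `l`).
The capstones `hsign_of_prop15iii` / `hfree_of_prop15` (composition with t1's p416122 / p415695) follow in
`EtaleThetaDataSignOfFacts.lean`. [EtTh] is refereed; nothing here bears on [IUTchIII] Cor. 3.12. typed ≠ proved.
-/
namespace Literature.IUT.HodgeArakelov

open Literature.AnabelianGeometry.EtaleTheta (ContH1 contCocycles)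
open Literature.AnabelianGeometry.EtaleTheta
open EtaleThetaDataOfSetting

noncomputable section

namespace EtaleThetaDataOfSetting

variable {p : ℕ} [Fact p.Prime] {D : Literature.AnabelianGeometry.EtaleTheta.ThetaSetting p}
  {E : D.EtaleThetaData} {l : ℕ} (C : E.DoubleUnderline l)

/-! ## The `X̲̲`-layer inputs of (R3): `[Π^tp_Ÿ : Π^tp_Ÿ̲̲] = [Δ^tp_Ÿ : Δ^tp_Ÿ̲̲] = l` -/

/-- `Π_Ÿ(Π) = Π^tp_Ÿ̲̲` read back in `Π^tp_X`: `(Π_Ÿ(Π) ∩ ⊤) ↦ Π^tp_Ÿ ∩ Π^tp_X̲̲`. [cite: MochizukiEtTh2009, Def 2.7 p.41] -/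
theorem map_subtype_piYdd_inf_top : (PiYdd C ⊓ ⊤).map C.Huu.subtype = D.GtpYdd ⊓ C.Huu := by
  rw [inf_top_eq]
  change (C.GtpYdduu.subgroupOf C.Huu).map C.Huu.subtype = _
  rw [Subgroup.subgroupOf_map_subtype, inf_assoc, inf_idem]

/-- A `toLZ`-generator `γ` of `Π^tp_X̲̲` has image `l ≠ 0` in `Z` (`toZ = l · toLZ` on `Π^tp_X̲̲`, "`Y̲̲ → Y` of degree
`l`"). [cite: MochizukiEtTh2009, Def 2.13 (i) p.47] -/
theorem toZ_ne_one_of_toLZ (γ : Pi C) (hγ : C.toLZ γ = Multiplicative.ofAdd 1) : D.toZ (γ : D.PiTemp) ≠ 1 := by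
  have hz : C.zExp γ = 1 := by
    have h := hγ
    change Multiplicative.ofAdd (C.zExp γ) = Multiplicative.ofAdd 1 at h
    exact Multiplicative.ofAdd.injective h
  intro h1
  have h2 := C.toZ_eq γ
  rw [h1, toAdd_one, hz, mul_one] at h2
  exact C.l_ne_zero (by exact_mod_cast h2.symm)

/-- **`[Π^tp_Ÿ : Π^tp_Ÿ̲̲] = l`** ("`Ÿ̲̲ → Ÿ` … of degree `l`", p. 41) — from `[Π^tp_Y : Π^tp_Ÿ] = 2`,
`[Π^tp_Y̲̲ : Π^tp_Ÿ̲̲] = 2` and `[Π^tp_Y : Π^tp_Y̲̲] = l`. [cite: MochizukiEtTh2009, Def 2.7 p.41] -/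
theorem relIndex_Huu_GtpYdd (hS : D.Sec2Hyps) : C.Huu.relIndex D.GtpYdd = l := by
  have key := Subgroup.relIndex_inf_mul_relIndex D.GtpYdd C.Huu D.GtpY
  have hl : C.Huu.relIndex D.GtpY = l := by
    rw [← Subgroup.inf_relIndex_right]; exact C.relIndex_Huu_GtpY
  rw [C.relIndex_GtpYdd_inf hS, hl,
    ← Subgroup.relIndex_mul_relIndex (D.GtpYdd ⊓ C.Huu) D.GtpYdd D.GtpY inf_le_left D.GtpYdd_le_GtpY,
    Subgroup.inf_relIndex_left, ThetaSetting.relIndex_GtpYdd_GtpY hS] at key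
  omega

/-- `Π^tp_Ÿ = Π^tp_Ÿ̲̲ · Δ^tp_Ÿ`: both `Π^tp_Ÿ̲̲` and `Π^tp_Ÿ` surject onto `G_K` ("`G_K ≅ Π_X̲̲/Δ_X̲̲`", Prop. 2.2 (iii)
p. 37; this seat's field `map_aug_Ydduu`). [cite: MochizukiEtTh2009, Prop 2.2 (iii) p.37] -/
theorem sup_inf_deltaTemp_eq_GtpYdd :
    (C.Huu ⊓ D.GtpYdd) ⊔ (D.GtpYdd ⊓ D.DeltaTemp) = D.GtpYdd := by
  refine le_antisymm (sup_le inf_le_right inf_le_left) fun g hg => ?_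
  have hmem : D.aug.toMonoidHom g ∈ (D.GtpYdd ⊓ C.Huu).map D.aug.toMonoidHom := by
    rw [C.map_aug_Ydduu]
    exact D.aug_mem_GK g
  obtain ⟨h, hh, hhg⟩ := hmem
  have hΔ : h⁻¹ * g ∈ D.DeltaTemp := by
    change h⁻¹ * g ∈ D.aug.toMonoidHom.ker
    rw [MonoidHom.mem_ker, map_mul, map_inv, hhg, inv_mul_cancel]
  rw [← mul_inv_cancel_left h g]
  exact Subgroup.mul_mem_sup
    (Subgroup.mem_inf.mpr ⟨(Subgroup.mem_inf.mp hh).2, (Subgroup.mem_inf.mp hh).1⟩)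
    (Subgroup.mem_inf.mpr ⟨D.GtpYdd.mul_mem (D.GtpYdd.inv_mem (Subgroup.mem_inf.mp hh).1) hg, hΔ⟩)

/-- **`[Δ^tp_Ÿ : Δ^tp_Ÿ̲̲] = l`**: the geometric index equals the full index `[Π^tp_Ÿ : Π^tp_Ÿ̲̲] = l` because
`Π^tp_Ÿ = Π^tp_Ÿ̲̲ · Δ^tp_Ÿ` (`Δ^tp_Ÿ = Π^tp_Ÿ ∩ Δ^tp_X` normal, `Π^tp_Ÿ ⊴ Π^tp_X` under `Compat`).
[cite: MochizukiEtTh2009, Def 2.7 p.41] -/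
theorem relIndex_geometric (hC : D.Compat) (hS : D.Sec2Hyps) :
    (C.Huu ⊓ (D.GtpYdd ⊓ D.DeltaTemp)).relIndex (D.GtpYdd ⊓ D.DeltaTemp) = l := by
  haveI := hC.GtpYdd_normal
  haveI : D.DeltaTemp.Normal := inferInstanceAs (D.aug.toMonoidHom.ker).Normal
  haveI : (D.GtpYdd ⊓ D.DeltaTemp).Normal := inferInstance
  have h1 := ThetaCovers.CoverData.relIndex_sup_eq_relIndex_of_normal (C.Huu ⊓ D.GtpYdd) (D.GtpYdd ⊓ D.DeltaTemp)
  rw [sup_inf_deltaTemp_eq_GtpYdd, Subgroup.inf_relIndex_right, relIndex_Huu_GtpYdd C hS] at h1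
  -- h1 : l = (Huu ⊓ Ydd).relIndex (Ydd ⊓ Δ)
  have h2 : (C.Huu ⊓ D.GtpYdd) ⊓ (D.GtpYdd ⊓ D.DeltaTemp) = C.Huu ⊓ (D.GtpYdd ⊓ D.DeltaTemp) := by
    rw [inf_assoc, ← inf_assoc D.GtpYdd D.GtpYdd D.DeltaTemp, inf_idem]
  rw [← Subgroup.inf_relIndex_right (C.Huu ⊓ D.GtpYdd) (D.GtpYdd ⊓ D.DeltaTemp), h2] at h1
  exact h1.symm

/-- **t1's input `hpow`**: every `l`-th power of an element of `(Δ^tp_Ÿ)^Θ` lies in the image of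
`Δ^tp_Ÿ̲̲ = Π^tp_Ÿ̲̲ ∩ Δ^tp_X` — because `(Δ^tp_Y)^Θ ⊇ (Δ^tp_Ÿ)^Θ` is ABELIAN (this seat's `dtpYTheta_comm` under
`IsEtThOrigin`, [EtTh] §1 p. 12 "abelian profinite groups") and the image of `Δ^tp_Ÿ̲̲` has index dividing
`[Δ^tp_Ÿ : Δ^tp_Ÿ̲̲] = l`. [cite: MochizukiEtTh2009, §1 p.12] -/
theorem pow_mem_map_of_origin (hC : D.Compat) (hS : D.Sec2Hyps) (hO : D.IsEtThOrigin) :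
    ∀ g ∈ (D.DtpYddN 1).map D.toTheta,
      g ^ l ∈ ((PiYdd C ⊓ ⊤).map C.Huu.subtype ⊓ D.DeltaTemp).map D.toTheta := by
  intro g hg
  have hN1 : D.DtpYddN 1 = D.GtpYdd ⊓ D.DeltaTemp := rfl
  have hA : (PiYdd C ⊓ ⊤).map C.Huu.subtype ⊓ D.DeltaTemp = C.Huu ⊓ (D.GtpYdd ⊓ D.DeltaTemp) := by
    rw [map_subtype_piYdd_inf_top, inf_comm D.GtpYdd C.Huu, inf_assoc]
  rw [hN1] at hg
  rw [hA]
  -- the surjection `Δ^tp_Ÿ ↠ (Δ^tp_Ÿ)^Θ` and the image `K` of `Δ^tp_Ÿ̲̲`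
  let N : Subgroup D.PiTemp := D.GtpYdd ⊓ D.DeltaTemp
  let A₀ : Subgroup D.PiTemp := C.Huu ⊓ (D.GtpYdd ⊓ D.DeltaTemp)
  let f : ↥N →* ↥(N.map D.toTheta) := D.toTheta.subgroupMap N
  let K : Subgroup ↥(N.map D.toTheta) := (A₀.subgroupOf N).map f
  -- `(Δ^tp_Ÿ)^Θ` is abelian, so `K` is normal
  have hNle : N.map D.toTheta ≤ D.DtpYTheta :=
    Subgroup.map_mono (inf_le_inf_right D.DeltaTemp D.GtpYdd_le_GtpY)
  have hcomm : ∀ a b : ↥(N.map D.toTheta), a * b = b * a := fun a b =>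
    Subtype.ext (D.dtpYTheta_comm hO a.1 (hNle a.2) b.1 (hNle b.2))
  haveI : K.Normal := ⟨fun k hk a => by rw [hcomm a k, mul_inv_cancel_right]; exact hk⟩
  -- its index divides `[Δ^tp_Ÿ : Δ^tp_Ÿ̲̲] = l`
  have hidx : K.index ∣ l := by
    have h := Subgroup.index_map_dvd (A₀.subgroupOf N) (MonoidHom.subgroupMap_surjective D.toTheta N)
    have hrel : (A₀.subgroupOf N).index = l := relIndex_geometric C hC hS
    rw [hrel] at h
    exact h
  -- hence `g ^ l ∈ K`
  obtain ⟨q, hq⟩ := hidx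
  have hmem : (⟨g, hg⟩ : ↥(N.map D.toTheta)) ^ l ∈ K := by
    rw [hq, pow_mul]
    exact K.pow_mem (Subgroup.pow_index_mem K _) q
  -- read `K` back in `(Π^tp_X)^Θ`
  obtain ⟨n, hn, hfn⟩ := hmem
  refine ⟨(n : D.PiTemp), Subgroup.mem_subgroupOf.mp hn, ?_⟩
  have := congrArg (fun y : ↥(N.map D.toTheta) => (y : D.GtpTheta)) hfn
  simpa [f] using this

end EtaleThetaDataOfSetting

end

end Literature.IUT.HodgeArakelov
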